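import Literature.Claims.NS.ClayVariants
import Literature.Analysis.FluidPDE.VectorCalculus
import Literature.Analysis.FluidPDE.ClassicalSolution
import Literature.Analysis.FunctionSpaces.LittlewoodPaleyKernel
import Literature.Analysis.FluidPDE.NSLerayHopfSereginEnergyProofs
import Literature.Analysis.FluidPDE.LittlewoodPaleyFields
import Literature.Analysis.FluidPDE.TaoEnstrophyLocalisation
import HarnessLib

/-!
# Claim skeleton C89 — Tennant, «Global Regularity of 3D Navier–Stokes: Helical Null-Form, Coifman–Meyer Estimate, and Compactness–Rigidity Closure in Ḃ^{1/2}_{2,1}» (2025)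

**Cite header.** William Tennant, *Global Regularity of 3D Navier–Stokes: Helical Null-Form,
Coifman–Meyer Estimate, and Compactness–Rigidity Closure in `Ḃ^{1/2}_{2,1}`*, Authorea preprint
doi:10.22541/au.175758858.89084851/v1 = figshare 10.6084/m9.figshare.30045250 **v4** (10 Sep 2025,
25 pp.; PDF page = printed page; `(n.m)`/`(A.m)` = display numbers; line numbers = the cell's page
texts `sources/Tennant2025/figshare-30045250-v4/pages/pNNN.txt`) — TEXT OF RECORD of census row C89
(cell `ns-claims`, D-0090 NS-claims sweep; T3 row promoted by RULINGS v1.30a on the typist's ask: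
the body asserts Theorem 2.5 with «Proof.»); bib key `Tennant2025`. UNREFEREED CLAIM under
adjudication — the author's own label is «complete referee-grade attempt … We invite expert scrutiny
of each load-bearing step» (abstract p.1) / «Program Outline» (Thm 0.1). This file TYPES the
claimed statement and the load-bearing printed displays as `Prop`s and asserts none of them; every
`theorem` below is pure logic / real arithmetic (compositions, the Clay link, the print's own
parameter-tuning arithmetic, one elementary weight inequality). Nothing here is a theorem about
Navier–Stokes. [cite: Tennant2025, Thm 0.1 p.1; (2.1)–(2.3) p.4; (2.4)–(2.9) p.5–6; Thm 2.5 p.6;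
(4.2)–(4.3) p.8; Thm 5.3 p.12; (A.1)–(A.8) p.13–14; Lemmas A.3–A.4, Thm A.5 p.15]

**Claimed statement (verbatim, p.1 l.28–32).** «Theorem 0.1 (Main Theorem (Program Outline)). For
any smooth divergence-free u₀ ∈ C^∞_c(ℝ³), the strategy developed in Sections 2–7 (helical
null–form Coifman-Meyer estimate, parabolic Morawetz coercivity, and compactness–rigidity) precludes
finite-time blow-up for the 3D incompressible Navier–Stokes flow.» Setting §0 p.1 l.20–27: `ℝ³`,
`ν > 0`, zero forcing; «The Clay problem asks for global classical solutions with bounded energy and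
no finite-time blow-up»; «Compliance with Clay» p.12 l.95–100: domain `ℝ³`, `ν > 0`, zero forcing,
data smooth, divergence-free, finite energy. Typed as `ClaimedTheorem := claySpecCc.Regularity`:
Fefferman's regularity statement (A) with the DATA slot narrowed to compactly supported smooth data
(every such datum has `u, p ∈ C^∞(ℝ³ × [0,∞))` solving (1)–(3) with `f ≡ 0` and bounded energy (7)).
The load-bearing a priori estimate is **Theorem 2.5 p.6 l.13–22** («Coercive Morawetz inequality.
With (a,b,λ) and γ chosen by Lemma 2.4, d/dt M(t) + (c₀(a,b,λ)/2) ν‖u(t)‖²_H ≤ 0. Consequently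
∫₀^T‖u(t)‖²_H dt < ∞ on every finite interval [0,T]. Proof. Combine (2.3) with Lemma 2.4.»; restated
«line by line» as Thm A.5 p.15).

**Clay delta (`Literature.Claims.NS.ClayVariants` §3).** Δ4 DATA CLASS only: `C^∞_c ⊊ (4)`. The
claim is a CONSEQUENCE of (A) (`claimed_of_clayA`, PROVED via
`HasRapidSpatialDecay.of_hasCompactSupport`); the converse needs the unprinted density/stability
statement `ClayDelta` (`clay_of_claimed_of_delta` PROVED). Domain `ℝ³`, `f ≡ 0`, `∀ ν > 0`,
solutions `C^∞` on `ℝ³ × [0,∞)` with (7), horizon `[0,∞)`: all `=`. Not a «wrong problem» candidate.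

**Objects (all over the tree's homogeneous Littlewood–Paley blocks `FunctionSpaces.blockFn j`
= `Δ_j`, «the standard homogeneous Littlewood–Paley decomposition» p.1 l.34–35).** `u_j := Δ_j u`,
`ω_j := Δ_j(∇ × u)` (p.4 l.37); `M` = (2.1)/(A.2); `‖·‖²_H` = Def 2.1/(0.1)/(A.1)/(4.1), typed as a TRUE
`ℝ≥0∞`-valued sum `hNormE` (no summability side condition, no junk value; the print asserts its
finiteness on the data class, p.2 l.1–4 «for smooth, compactly supported divergence–free data … all
homogeneous Besov norms are finite»); `Visc`, `Nonlin` = the two halves of (A.4) p.14. Every display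
of the shape «X ≤ C‖u‖²_H» is typed `ENNReal.ofReal C * hNormE u ≤ ENNReal.ofReal X` (for finite
`‖u‖²_H` and `X ≥ 0` this is the printed real inequality; it also records the finiteness the print
asserts). FIELD-LEVEL displays ((2.2), (A.5), (A.6), (2.3)–(2.6), Lemma 2.4(1)/A.3) are typed on the
class `IsTestField` = the print's own data class `C^∞_c`, divergence-free (the `t = 0` slices of the
solutions the displays are asserted for «for all t»; the class is closed under the dyadic dilations
`u ↦ 2^k u(2^k ·)` and under `u ↦ −u`). The localized sums `S_near`, `S_trans` of (2.4)–(2.5) are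
built from trilinear pieces `T^{αβ}_{j,m,ℓ}` that the print never defines in closed form (Lemma 1.5
p.4 bounds them against test functions `Φ_j` that App. A.1 p.13 NORMALISES); following the cell's F17
convention their sum enters the nonlinear-side steps as an explicit PARAMETER
`S : Params → ℝ → (E3 → E3) → ℝ` (`S p γ u = S_near + S_trans` at parameters `p = (a,b,λ)`, aperture
`γ`, slice `u`), constrained only by what the print asserts about it.

**ORDERED STEP INDEX** (dependency order of the printed argument, ties by print order; «Step k» on
the buses = this list):
* Step 1 = `Step_L23` — Lemma 2.3 p.5 l.12–16 (= Lemma A.2 p.14 l.56–65): `a2^{2j} + b2^{4j} ≥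
  c₁ log(2+2^j) 2^{3j}` for all `j ∈ ℤ`. Elementary and TRUE: `step_L23_holds` PROVED below.
* Step 2 = `Step_22` — (2.2) p.4 l.53–77 (= (A.3) p.13): `M(t) ≥ 0` for `0 < λ < √(ab)`.
* Step 3 = `Step_A5` — (A.5) p.14 l.38–55 (= Prop 2.2 proof p.5 l.20–26 «The viscous part is a
  positive definite dyadic 2×2 form in (∇u_j, ∇ω_j); Bernstein gives ‖∇u_j‖²₂ ∼ 2^{2j}‖u_j‖²₂»):
  `Visc ≤ −ν Σ_j (A2^{2j} + B2^{4j})‖u_j‖²₂` for some `A, B > 0` depending on `(a,b,λ)`.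
* Step 4 = `Step_A6` — (A.6) p.14 l.66–69 «Visc ≤ −c₀(a,b,λ) ν ‖u‖²_H (Compare with the statement
  of Proposition 2.2)» = the viscous gain «c₀(a,b,λ)ν‖u(t)‖²_H» on the left of (2.3) p.4 l.87–96.
  `stepA6_of_L23_A5 : Step_L23 → Step_A5 → Step_A6` PROVED (the print's one-line derivation).
* Step 5 = `Step_23 S` — Prop 2.2 (2.3) p.4 l.87–96 with (2.4)–(2.5) p.5 l.28–54 and A.3 p.14
  l.71–77: the nonlinear part `Nonlin` of `dM/dt` is carried by the localized sums,
  `Nonlin ≤ S_near + S_trans` («S_near, S_trans are the dyadic+angularly localized nonlinear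
  contributions issued from −P∇·(u⊗u)»).
* Step 6 = `Step_26 S` — (2.6) p.5 l.56–62 (= (A.7)–(A.8) p.14 l.78–87): `|S_near| ≤ C_near γ‖u‖²_H`,
  `|S_trans| ≤ C_trans‖u‖²_H`, «constants independent of the aperture γ ∈ (0,γ₀] and of the dyadic
  neighbor width C₀», typed for the sum: `|S| ≤ (C_near γ + C_trans)‖u‖²_H`.
* Step 7 = `Step_A3 S` — Lemma 2.4 item 1 p.5 l.73–74 (= Lemma A.3 p.15 l.2–4): under the common
  scaling `(a,b,λ) ↦ (τa,τb,τλ)`, «C_near, C_trans in (2.6) are unchanged».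
* (derived display) `CoerciveSlice` — Theorem 2.5 p.6 / Thm A.5 p.15 at the slice level
  (`Visc + Nonlin + (c₀/2)ν‖u‖²_H ≤ 0` on the data class): `coerciveSlice_of_steps :
  Step_A6 → Step_23 γ₀ S → Step_26 γ₀ S → Step_A3 γ₀ S → CoerciveSlice` PROVED for every `γ₀ > 0`
  (Lemma 2.4/A.4 (2.8)–(2.9) +
  Thm A.5; the print's tuning gives `S_near + S_trans ≤ c₀ν‖u‖²_H`, not the `½c₀ν` of (2.7) — an
  immaterial factor 2, repaired in the proof by taking `τ`, `γ` twice as stringent).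
* Step 8 = `Step_Thm25` — Theorem 2.5 p.6 l.13–22 = (4.2) p.8 l.16–21, AS PRINTED along smooth
  solutions («d/dt M(t) + (c₀/2)ν‖u(t)‖²_H ≤ 0»), via (A.4) `dM/dt = Visc + Nonlin`.
* Step 9 = `Step_43` — (4.3) p.8 l.22–30 «In particular, for any 0 ≤ t₀ < T,
  ∫_{t₀}^T ‖u(t)‖²_H dt ≤ M(t₀)/(c₀ν)» (integration of (4.2) using Step 2).
* Step 10 = `Step_KM` — §§3–5 at QUICK grain: Cor 3.3 p.8 l.46–60 (minimal blow-up element, almost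
  periodicity), Lemma 4.6 p.10 l.89 ff. / Cor 4.7 p.11 l.43–49 (good time: (4.3) ⇒ ‖u(t*)‖_X ≤ ε₀),
  Props 5.1–5.2 p.11–12 (critical LWP / small-data GWP, «standard … Bahouri–Chemin–Danchin,
  Secs. 3.3–3.4»), Thm 5.3 p.12 l.88–92 (no minimal blow-up): the Kenig–Merle closure converting the
  a priori bound (4.3) into Theorem 0.1.
COMPOSITION: `claim_of_steps : Step_43 → Step_KM → ClaimedTheorem` PROVED (Thm 5.3's printed
logic consumes only (4.3) from §2); FIELD-LEVEL COMPOSITION `coerciveSlice_of_steps` PROVED. The link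
between the two layers is (A.4) «dM/dt = Visc + Nonlin» (a calculus identity along solutions) plus
the field displays at slices `t > 0` (which are not compactly supported); Steps 8–9 are therefore
typed as printed rather than derived from `CoerciveSlice`.

**Kernel notes for the refuter (nothing asserted).** Under the dyadic dilation
`u^{(k)}(x) = 2^k u(2^k x)` one has `Δ_j u^{(k)} = 2^k (Δ_{j−k}u)(2^k ·)` (tree
`FunctionSpaces.blockKernel_eq_scale`), hence EXACTLY `Visc(u^{(k)}) = 2^{3k}Visc(u)` and
`Nonlin(u^{(k)}) = 2^{3k}Nonlin(u)` (whatever their values: `tsum`/`∫` junk is dilation-covariant),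
`M(u^{(k)}) = 2^k M(u)`, while `hNormE u^{(k)} = 2^{2k} Σ_i log(2+2^{i+k}) 2^{3i}‖Δ_i u‖² ≥
2^{2k}·log 2·2^{3i₀}·‖Δ_{i₀}u‖²₂` (one block, `ENNReal.le_tsum`) and the (A.5) weight
`Σ A2^{2j}‖u^{(k)}_j‖² = 2^k Σ A2^{2i}‖u_i‖²`: Steps 3, 4 and `CoerciveSlice` compare a degree-3
quantity with degree-1 / degree-2 ones and are refuted by `k → −∞` at ANY test field with one
non-zero block (`FluidPDE.eLpNorm_sq_le_two_mul_tsum_eLpNorm_blockFn_sq` gives one for `u ≠ 0`;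
e.g. `Chishtie2025.datum`); barrier tool `Barriers.NavierStokesRegularity.ScalingAudit`. Step 1 is
proved; Step 2 is true termwise by Cauchy–Schwarz; Steps 5–7 carry the second, independent degree
mismatch (`Nonlin` is cubic, `‖u‖²_H` quadratic, constants `u`-independent) but a kernel refutation
there needs `S ≢ 0` for the undefined localized pieces; Steps 8–9 die on the Navier–Stokes dilates
of one non-zero solution (left side of (4.3) is scale-invariant, right side `∝ 2^k`).

WHAT THIS IS NOT: not a claim about NS regularity or blow-up; not a claim about any author beyond
the typed locator.
-/

open Set MeasureTheory Literature.Analysis.FluidPDE Literature.Analysis.FunctionSpaces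
  Literature.Claims.NS.ClayVariants
open scoped ENNReal ContDiff RealInnerProductSpace

namespace Literature.Claims.NS.Tennant2025

noncomputable section

/-- Physical space `ℝ³`. [folklore] -/
abbrev E3 : Type := EuclideanSpace ℝ (Fin 3)

/-! ## The statement (Theorem 0.1 p.1) and its Clay link -/

/-- The author's problem spec: Clay's whole-space spec with the DATA slot narrowed to compactly
supported data («u₀ ∈ C^∞_c(ℝ³)», Thm 0.1 p.1 l.28), forces (5) and admissibility (7) as in (A)/(C)
(«Compliance with Clay … Data: smooth, divergence-free, finite energy», p.12 l.95–100).
[cite: Tennant2025, Thm 0.1 p.1 l.28–32; p.12 l.95–100] -/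
def claySpecCc : ClaySpec where
  data := fun u₀ => HasCompactSupport u₀
  force := HasRapidSpaceTimeDecay
  admissible := fun u _ => HasBoundedEnergy u

/-- **The claimed theorem (Theorem 0.1 «Main Theorem (Program Outline)», p.1 l.28–32, as printed)**:
«For any smooth divergence-free u₀ ∈ C^∞_c(ℝ³), the strategy developed in Sections 2–7 … precludes
finite-time blow-up for the 3D incompressible Navier–Stokes flow» (`ℝ³`, every `ν > 0`, zero
forcing, §0 p.1 l.20–27), read with «Compliance with Clay» p.12 l.95–100: every such datum has
`u, p ∈ C^∞(ℝ³ × [0,∞))` solving (1)–(3) with `f ≡ 0` and bounded energy (7) — Clay's regularity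
statement AT THE DATA CLASS `C^∞_c`. [cite: Tennant2025, Thm 0.1 p.1 l.28–32] -/
def ClaimedTheorem : Prop := claySpecCc.Regularity

/-- Clay (A) implies the claim: `C^∞_c ⊂ (4)` (`HasRapidSpatialDecay.of_hasCompactSupport`), so the
claimed statement is a CONSEQUENCE of (A) on the data axis (Δ4, narrower data). PROVED.
[cite: FeffermanClay2006, statement (A) with (4), CMI offprint p. 2] -/
theorem claimed_of_clayA (h : clayR3.Regularity) : ClaimedTheorem := by
  intro ν hν u₀ hsm hdiv hcs
  exact h ν hν u₀ hsm hdiv (HasRapidSpatialDecay.of_hasCompactSupport hsm hcs)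

/-- **Clay delta (Δ4 DATA CLASS)**: the one extra hypothesis under which the claim gives (A)
verbatim — regularity for all compactly supported smooth divergence-free data at viscosity `ν`
implies regularity for all data of Fefferman's class (4) at `ν` (a density/stability statement the
text does not print; «Compliance with Clay» p.12 lists the data as «smooth, divergence-free, finite
energy» without addressing `(4) ⊋ C^∞_c`). [cite: Tennant2025, p.12 l.95–100; Thm 0.1 p.1] -/
def ClayDelta : Prop := ∀ ν : ℝ, 0 < ν → claySpecCc.RegularityAt ν → clayR3.RegularityAt ν

/-- With the delta, the claim would settle (A). PROVED (logic).
[cite: FeffermanClay2006, statement (A), CMI offprint p. 2] -/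
theorem clay_of_claimed_of_delta (hΔ : ClayDelta) (h : ClaimedTheorem) : clayR3.Regularity :=
  fun ν hν => hΔ ν hν (h ν hν)

/-! ## Littlewood–Paley functionals of §2 / App. A (definitions only) -/

/-- The dyadic number `2^j`, `j ∈ ℤ`. [folklore] -/
def dy (j : ℤ) : ℝ := (2 : ℝ) ^ j

/-- `2^j > 0`. [folklore] -/
private theorem dy_pos (j : ℤ) : 0 < dy j := zpow_pos two_pos j

/-- `‖Δ_j v‖²_{L²}` as an extended non-negative real (lower Lebesgue integral; no junk value).
[cite: Tennant2025, Preliminaries p.1 l.34–36; (A.1) p.13] -/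
def blockL2E (j : ℤ) (v : E3 → E3) : ℝ≥0∞ := ∫⁻ x, ‖blockFn j v x‖ₑ ^ 2

/-- `‖Δ_j v‖²_{L²}` as a real number (Bochner integral). [cite: Tennant2025, (2.1) p.4] -/
def blockL2sq (j : ℤ) (v : E3 → E3) : ℝ := ∫ x, ‖blockFn j v x‖ ^ 2

/-- `⟨Δ_j v, Δ_j w⟩_{L²}`. [cite: Tennant2025, (2.1) p.4 (the pairing ⟨u_j, ω_j⟩)] -/
def blockPair (j : ℤ) (v w : E3 → E3) : ℝ := ∫ x, ⟪blockFn j v x, blockFn j w x⟫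

/-- The Frobenius pairing `∑ᵢ ⟪A eᵢ, B eᵢ⟫` of two linear maps on `ℝ³` (for `⟨∇u_j, ∇ω_j⟩`).
[folklore] -/
def frobPair (A B : E3 →L[ℝ] E3) : ℝ :=
  ∑ i : Fin 3, ⟪A (EuclideanSpace.single i (1 : ℝ)), B (EuclideanSpace.single i (1 : ℝ))⟫

/-- `⟨∇Δ_j v, ∇Δ_j w⟩_{L²} = ∫ ∑ᵢ ⟪∂ᵢ Δ_j v, ∂ᵢ Δ_j w⟫` (for `‖∇u_j‖²₂`, `‖∇ω_j‖²₂`, `⟨∇u_j, ∇ω_j⟩`).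
[cite: Tennant2025, (A.4) viscous part p.14 l.22–37] -/
def gradBlockPair (j : ℤ) (v w : E3 → E3) : ℝ :=
  ∫ x, frobPair (fderiv ℝ (blockFn j v) x) (fderiv ℝ (blockFn j w) x)

/-- The weight of Def 2.1: `log(2 + 2^j) 2^{3j}`. [cite: Tennant2025, Def 2.1 p.4 l.78–84; (0.1) p.2; (A.1) p.13; (4.1) p.8] -/
def hWeight (j : ℤ) : ℝ := Real.log (2 + dy j) * dy j ^ 3

/-- **Def 2.1 p.4 l.78–84, the coercive target seminorm** `‖f‖²_H := Σ_{j∈ℤ} log(2+2^j) 2^{3j}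
‖Δ_j f‖²_{L²}`, as a true `ℝ≥0∞`-valued sum (finite on the data class by p.2 l.1–4).
[cite: Tennant2025, Def 2.1 p.4 l.78–84; (A.1) p.13] -/
def hNormE (v : E3 → E3) : ℝ≥0∞ := ∑' j : ℤ, ENNReal.ofReal (hWeight j) * blockL2E j v

/-- The parameters `(a, b, λ)` of the Morawetz functional (2.1). [cite: Tennant2025, (2.1) p.4 l.37–38] -/
structure Params where
  /-- weight of `2^{2j}‖u_j‖²` -/
  a : ℝ
  /-- weight of `‖ω_j‖²` -/
  b : ℝ
  /-- cross weight `λ` of `2^j⟨u_j, ω_j⟩` -/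
  lam : ℝ

/-- «Fix a, b > 0 and 0 < λ < √(ab)» (p.4 l.37–38), without the square root: `0 < λ`, `λ² < ab`.
[cite: Tennant2025, (2.1) p.4 l.37–38] -/
def Params.Admissible (p : Params) : Prop := 0 < p.a ∧ 0 < p.b ∧ 0 < p.lam ∧ p.lam ^ 2 < p.a * p.b

/-- The common scaling `(a,b,λ) ↦ (τa, τb, τλ)` of Lemma 2.4 item 1 / Lemma A.3.
[cite: Tennant2025, Lemma 2.4 (1) p.5 l.73; Lemma A.3 p.15 l.2] -/
def Params.scale (τ : ℝ) (p : Params) : Params := ⟨τ * p.a, τ * p.b, τ * p.lam⟩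

/-- Common scaling by `τ > 0` preserves admissibility. [cite: Tennant2025, Lemma 2.4 p.5 l.63–74] -/
theorem Params.Admissible.scale {p : Params} (hp : p.Admissible) {τ : ℝ} (hτ : 0 < τ) :
    (p.scale τ).Admissible := by
  obtain ⟨ha, hb, hl, hab⟩ := hp
  refine ⟨mul_pos hτ ha, mul_pos hτ hb, mul_pos hτ hl, ?_⟩
  have : (τ * p.lam) ^ 2 = τ ^ 2 * p.lam ^ 2 := by ring
  rw [Params.scale, this]
  nlinarith [mul_pos hτ hτ]

/-- **(2.1) p.4 / (A.2) p.13, the parabolic Morawetz functional** at one time slice: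
`M = Σ_j [a 2^{2j}‖u_j‖²₂ + b‖ω_j‖²₂ − 2λ 2^j⟨u_j, ω_j⟩]`, `u_j = Δ_j u`, `ω_j = Δ_j(∇×u)` (typed as
`a·Σ + b·Σ − 2λ·Σ`, the print's absolutely convergent reading). [cite: Tennant2025, (2.1) p.4 l.39–52; (A.2) p.13] -/
def morawetzM (p : Params) (v : E3 → E3) : ℝ :=
  p.a * (∑' j : ℤ, dy j ^ 2 * blockL2sq j v) + p.b * (∑' j : ℤ, blockL2sq j (curl v))
    - 2 * p.lam * (∑' j : ℤ, dy j * blockPair j v (curl v))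

/-- **(A.4) p.14 l.22–37, the viscous part of `dM/dt`**:
`Visc = −2aν Σ 2^{2j}‖∇u_j‖²₂ − 2bν Σ ‖∇ω_j‖²₂ + 4λν Σ 2^j⟨∇u_j, ∇ω_j⟩`.
[cite: Tennant2025, (A.4) p.14 l.22–37; Prop 2.2 proof p.5 l.17–26] -/
def viscForm (p : Params) (ν : ℝ) (v : E3 → E3) : ℝ :=
  -(2 * p.a * ν) * (∑' j : ℤ, dy j ^ 2 * gradBlockPair j v v)
    - 2 * p.b * ν * (∑' j : ℤ, gradBlockPair j (curl v) (curl v))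
    + 4 * p.lam * ν * (∑' j : ℤ, dy j * gradBlockPair j v (curl v))

/-- The right side of (A.5): `Σ_j (A2^{2j} + B2^{4j}) ‖u_j‖²₂` as a true `ℝ≥0∞`-valued sum.
[cite: Tennant2025, (A.5) p.14 l.44–55] -/
def dissipE (A B : ℝ) (v : E3 → E3) : ℝ≥0∞ :=
  ∑' j : ℤ, ENNReal.ofReal (A * dy j ^ 2 + B * dy j ^ 4) * blockL2E j v

/-- **(A.4) p.14, the nonlinear part of `dM/dt`**, with `∂ₜu = νΔu − P∇·(u⊗u)`, `∂ₜω = νΔω +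
∇×(−P∇·(u⊗u))` (p.5 l.17–19) inserted: `Nonlin = −[2a Σ 2^{2j}⟨Δ_j((u·∇)u), u_j⟩ +
2b Σ ⟨Δ_j ∇×((u·∇)u), ω_j⟩ − 2λ Σ 2^j(⟨Δ_j((u·∇)u), ω_j⟩ + ⟨u_j, Δ_j ∇×((u·∇)u)⟩)]`. TYPING NOTE: the
Leray projector's gradient part `∇q` of `P∇·(u⊗u) = (u·∇)u + ∇q` drops out of every pairing shown
(the blocks `u_j`, `ω_j` are divergence-free and `Δ_j` commutes with derivatives; `∇×∇q = 0`), so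
`Nonlin` is typed with `(u·∇)u = convect u u` in place of `P∇·(u⊗u)`.
[cite: Tennant2025, (A.4) p.14 l.2–21; A.3 p.14 l.71–77; Prop 2.2 proof p.5 l.17–19] -/
def nonlinForm (p : Params) (v : E3 → E3) : ℝ :=
  -(2 * p.a * (∑' j : ℤ, dy j ^ 2 * blockPair j (convect v v) v)
      + 2 * p.b * (∑' j : ℤ, blockPair j (curl (convect v v)) (curl v))
      - 2 * p.lam * (∑' j : ℤ, dy j * (blockPair j (convect v v) (curl v)
          + blockPair j v (curl (convect v v)))))

/-- Lemma A.3's «multiplies M … by τ»: definitionally. [cite: Tennant2025, Lemma A.3 p.15 l.2–3] -/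
theorem morawetzM_scale (p : Params) (τ : ℝ) (v : E3 → E3) :
    morawetzM (p.scale τ) v = τ * morawetzM p v := by
  simp only [morawetzM, Params.scale]
  ring

/-- Lemma A.3's «hence multiplies the viscous constant … by τ»: `Visc` is linear in `(a,b,λ)`.
[cite: Tennant2025, Lemma A.3 p.15 l.2–3] -/
theorem viscForm_scale (p : Params) (τ ν : ℝ) (v : E3 → E3) :
    viscForm (p.scale τ) ν v = τ * viscForm p ν v := by
  simp only [viscForm, Params.scale]
  ring

/-- `Nonlin` is linear in `(a,b,λ)` as well (the print's «multiplies M and Ṁ by τ», Ṁ = Visc +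
Nonlin). [cite: Tennant2025, Lemma A.3 p.15 l.2–3; (A.4) p.14] -/
theorem nonlinForm_scale (p : Params) (τ : ℝ) (v : E3 → E3) :
    nonlinForm (p.scale τ) v = τ * nonlinForm p v := by
  simp only [nonlinForm, Params.scale]
  ring

/-- The fields the §2 displays are applied to here: smooth, compactly supported, divergence-free —
the print's data class «u₀ ∈ C^∞_c(ℝ³)» (Thm 0.1 p.1; p.2 l.1–4), i.e. the `t = 0` slices of the
«smooth divergence-free solutions» of Prop 2.2; closed under `u ↦ 2^k u(2^k ·)` and `u ↦ −u`.
[cite: Tennant2025, Thm 0.1 p.1 l.28; p.2 l.1–4; Prop 2.2 p.4 l.87–88] -/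
def IsTestField (u : E3 → E3) : Prop :=
  ContDiff ℝ ∞ u ∧ HasCompactSupport u ∧ NSWave0.IsDivFree u

/-! ## §2 / App. A: the printed displays, field level (typed, not asserted) -/

/-- **Step 1 — Lemma 2.3 p.5 l.12–16 (= Lemma A.2 p.14)**: «For any a, b > 0 and 0 < λ < √(ab) there
exists c₁ = c₁(a,b,λ) > 0 such that a2^{2j} + b2^{4j} ≥ c₁ log(2 + 2^j) 2^{3j} ∀j ∈ ℤ» (λ plays no
role in the display). TRUE: `step_L23_holds`. [cite: Tennant2025, Lemma 2.3 p.5 l.12–16; Lemma A.2 p.14 l.56–65] -/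
def Step_L23 : Prop :=
  ∀ a b : ℝ, 0 < a → 0 < b → ∃ c : ℝ, 0 < c ∧ ∀ j : ℤ, c * hWeight j ≤ a * dy j ^ 2 + b * dy j ^ 4

/-- **Step 2 — (2.2) p.4 l.53–77 (= (A.3) p.13)**: «For each j, the dyadic quadratic form … is
positive definite since ab − λ² > 0; hence M(t) ≥ (1 − λ/√(ab)) Σ_j (a2^{2j}‖u_j‖² + b‖ω_j‖²) ≥ 0»,
typed as the consequence (4.3) consumes: `M ≥ 0` on the data class.
[cite: Tennant2025, (2.2) p.4 l.53–77; (A.3) p.13 l.30–54] -/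
def Step_22 : Prop :=
  ∀ p : Params, p.Admissible → ∀ u : E3 → E3, IsTestField u → 0 ≤ morawetzM p u

/-- **Step 3 — (A.5) p.14 l.38–55 (= Prop 2.2 proof p.5 l.20–26)**: «Diagonalize the dyadic 2×2
form in (∇u_j, ∇ω_j) and use ‖∇u_j‖²₂ ∼ 2^{2j}‖u_j‖²₂ to obtain Visc ≤ −ν Σ_j (A2^{2j} + B2^{4j})
‖u_j‖²₂ (A.5) for some A, B > 0 depending on (a, b, λ)», for every admissible `(a,b,λ)`, every
`ν > 0`, every field of the class. [cite: Tennant2025, (A.5) p.14 l.38–55; p.5 l.20–26] -/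
def Step_A5 : Prop :=
  ∀ p : Params, p.Admissible → ∃ A B : ℝ, 0 < A ∧ 0 < B ∧ ∀ ν : ℝ, 0 < ν →
    ∀ u : E3 → E3, IsTestField u →
      ENNReal.ofReal ν * dissipE A B u ≤ ENNReal.ofReal (-viscForm p ν u)

/-- **Step 4 — (A.6) p.14 l.66–69 «From (A.5) and Lemma A.2, Visc ≤ −c₀(a,b,λ) ν ‖u‖²_H»** = the
viscous gain `c₀(a,b,λ) ν ‖u(t)‖²_H` on the left of (2.3), Prop 2.2 p.4 l.87–96 («The viscous
contribution produces the H-gain; the logarithm is absorbed dyadically (Lemma 2.3)»).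
[cite: Tennant2025, (A.6) p.14 l.66–70; Prop 2.2 (2.3) p.4 l.87–96] -/
def Step_A6 : Prop :=
  ∀ p : Params, p.Admissible → ∃ c₀ : ℝ, 0 < c₀ ∧ ∀ ν : ℝ, 0 < ν →
    ∀ u : E3 → E3, IsTestField u →
      ENNReal.ofReal (c₀ * ν) * hNormE u ≤ ENNReal.ofReal (-viscForm p ν u)

/-- **Step 5 — Prop 2.2 (2.3) p.4 l.87–96 with (2.4)–(2.5) p.5 l.28–54 / A.3 p.14 l.71–77**:
«d/dt M(t) + c₀(a,b,λ)ν‖u(t)‖²_H ≤ S_near(t) + S_trans(t), (2.3) where S_near, S_trans are the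
dyadic+angularly localized nonlinear contributions issued from −P∇·(u⊗u)» — given (A.4) `dM/dt =
Visc + Nonlin` and the viscous gain (Step 4), the content is that the nonlinear part is CARRIED by the
localized sums: `Nonlin ≤ S_near + S_trans`, for every admissible `(a,b,λ)`, aperture `γ ∈ (0,γ₀]`
(«fix a cap–aperture bound γ₀ ∈ (0,1]», p.2 l.21; `γ₀` is a parameter of Steps 5–7) and field of the
class; `S p γ u` = `S_near + S_trans` (parameter, see the module docstring). [cite: Tennant2025, Prop 2.2 (2.3) p.4 l.87–96; (2.4)–(2.5) p.5 l.28–54; A.3 p.14 l.71–77] -/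
def Step_23 (γ₀ : ℝ) (S : Params → ℝ → (E3 → E3) → ℝ) : Prop :=
  ∀ p : Params, p.Admissible → ∀ γ : ℝ, 0 < γ → γ ≤ γ₀ →
    ∀ u : E3 → E3, IsTestField u → nonlinForm p u ≤ S p γ u

/-- **Step 6 — (2.6) p.5 l.56–62 (= (A.7)–(A.8) p.14 l.78–87)**: «Concretely, |S_near(t)| ≤ C_near γ
‖u(t)‖²_H, |S_trans(t)| ≤ C_trans ‖u(t)‖²_H, (2.6) with constants independent of the aperture
γ ∈ (0, γ₀] and of the dyadic neighbor width C₀», typed for the sum `S = S_near + S_trans`: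
constants quantified OUTSIDE (`∃ C_near C_trans, ∀ γ, ∀ u`), depending on `(a,b,λ)` at most.
[cite: Tennant2025, (2.6) p.5 l.56–62; (A.7)–(A.8) p.14 l.78–87] -/
def Step_26 (γ₀ : ℝ) (S : Params → ℝ → (E3 → E3) → ℝ) : Prop :=
  ∀ p : Params, p.Admissible → ∃ Cn Ct : ℝ, 0 ≤ Cn ∧ 0 ≤ Ct ∧ ∀ γ : ℝ, 0 < γ → γ ≤ γ₀ →
    ∀ u : E3 → E3, IsTestField u →
      ENNReal.ofReal |S p γ u| ≤ ENNReal.ofReal (Cn * γ + Ct) * hNormE u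

/-- **Step 7 — Lemma 2.4 item 1 p.5 l.73–74 (= Lemma A.3 p.15 l.2–4)**: «Common scaling: replace
(a,b,λ) by (τa, τb, τλ) with τ ≥ 1. Then c₀ scales to τ c_vis while C_near, C_trans in (2.6) are
unchanged»: any constants valid in (2.6) for `(a,b,λ)` remain valid for `(τa,τb,τλ)`, `τ ≥ 1`.
[cite: Tennant2025, Lemma 2.4 (1) p.5 l.73–74; Lemma A.3 p.15 l.2–4] -/
def Step_A3 (γ₀ : ℝ) (S : Params → ℝ → (E3 → E3) → ℝ) : Prop :=
  ∀ p : Params, p.Admissible → ∀ Cn Ct : ℝ,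
    (∀ γ : ℝ, 0 < γ → γ ≤ γ₀ → ∀ u : E3 → E3, IsTestField u →
        ENNReal.ofReal |S p γ u| ≤ ENNReal.ofReal (Cn * γ + Ct) * hNormE u) →
      ∀ τ : ℝ, 1 ≤ τ → ∀ γ : ℝ, 0 < γ → γ ≤ γ₀ → ∀ u : E3 → E3, IsTestField u →
        ENNReal.ofReal |S (p.scale τ) γ u| ≤ ENNReal.ofReal (Cn * γ + Ct) * hNormE u

/-- **Theorem 2.5 p.6 l.13–22 / Thm A.5 p.15 l.35–41 at the slice level** («d/dt M(t) +
(c₀(a,b,λ)/2) ν ‖u(t)‖²_H ≤ 0» with dM/dt = Visc + Nonlin by (A.4)): for every `ν > 0` there are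
admissible parameters and `c₀ > 0` with `Visc + Nonlin + (c₀/2)ν‖u‖²_H ≤ 0` on the data class. A
DERIVED display: `coerciveSlice_of_steps`. [cite: Tennant2025, Thm 2.5 p.6 l.13–22; Thm A.5 p.15 l.35–41] -/
def CoerciveSlice : Prop :=
  ∀ ν : ℝ, 0 < ν → ∃ p : Params, p.Admissible ∧ ∃ c₀ : ℝ, 0 < c₀ ∧
    ∀ u : E3 → E3, IsTestField u →
      ENNReal.ofReal (c₀ / 2 * ν) * hNormE u ≤ ENNReal.ofReal (-(viscForm p ν u + nonlinForm p u))

/-! ## §2 solution level and §§3–5 (typed, not asserted) -/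

/-- **Step 8 — Theorem 2.5 p.6 l.13–22 = (4.2) p.8 l.16–21, AS PRINTED along solutions**: for every
`ν > 0` there are `(a,b,λ)`, `c₀ > 0` (chosen by Lemma 2.4) such that for every smooth solution on
`[0,T)` from a datum of the class, `t ↦ M(t)` is differentiable on `[0,T)` and `d/dt M(t) +
(c₀/2) ν ‖u(t)‖²_H ≤ 0` (with `‖u(t)‖²_H` finite). [cite: Tennant2025, Thm 2.5 p.6 l.13–22; (4.2) p.8 l.16–21] -/
def Step_Thm25 : Prop :=
  ∀ ν : ℝ, 0 < ν → ∃ p : Params, p.Admissible ∧ ∃ c₀ : ℝ, 0 < c₀ ∧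
    ∀ u₀ : E3 → E3, IsTestField u₀ → ∀ T : ℝ, 0 < T →
      ∀ (u : ℝ → E3 → E3) (pr : ℝ → E3 → ℝ),
        IsClassicalNSSolutionOn (Ico 0 T) ν 0 u pr → u 0 = u₀ →
          ∀ t ∈ Ico 0 T, hNormE (u t) < ⊤ ∧ ∃ M' : ℝ,
            HasDerivWithinAt (fun s => morawetzM p (u s)) M' (Ico 0 T) t ∧
              M' + c₀ / 2 * ν * (hNormE (u t)).toReal ≤ 0

/-- **Step 9 — (4.3) p.8 l.22–30**: «In particular, for any 0 ≤ t₀ < T, ∫_{t₀}^T ‖u(t)‖²_H dt ≤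
M(t₀)/(c₀ν)» (integrating (4.2) and dropping `M(T) ≥ 0` by (2.2)); the a priori bound §4 feeds into
Lemma 4.6 (also as Lemma A.6 p.15 for the minimal element). Lower Lebesgue integral in time (no
measurability or integrability side condition). [cite: Tennant2025, (4.3) p.8 l.22–30; Thm 2.5 p.6 l.19–21] -/
def Step_43 : Prop :=
  ∀ ν : ℝ, 0 < ν → ∃ p : Params, p.Admissible ∧ ∃ c₀ : ℝ, 0 < c₀ ∧
    ∀ u₀ : E3 → E3, IsTestField u₀ → ∀ T : ℝ, 0 < T →
      ∀ (u : ℝ → E3 → E3) (pr : ℝ → E3 → ℝ),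
        IsClassicalNSSolutionOn (Ico 0 T) ν 0 u pr → u 0 = u₀ →
          ∀ t₀ ∈ Ico 0 T,
            ∫⁻ t in Ioo t₀ T, hNormE (u t) ≤ ENNReal.ofReal (morawetzM p (u t₀) / (c₀ * ν))

/-- **Step 10 — §§3–5, the Kenig–Merle closure at QUICK grain**: Cor 3.3 p.8 l.46–60 (a minimal
blow-up solution `u_c`, almost periodic modulo symmetries in `X = Ḃ^{1/2}_{2,1}`, exists as soon as
some datum blows up), Lemma 4.6 p.10 / Cor 4.7 p.11 l.43–49 («Under the hypotheses of Lemma 4.6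
[`∫₀^{T_c}‖u‖²_H dt < ∞` and X-tightness], there exists t* < T_c such that ‖u(t*)‖_X ≤ ε₀»),
Props 5.1–5.2 p.11–12 (critical local theory and small-data global well-posedness, «standard by
Duhamel … Bahouri–Chemin–Danchin, Secs. 3.3–3.4»), Thm 5.3 p.12 l.88–92 («a minimal blow-up
solution u_c cannot blow up in finite time … hence u_c extends past T_c, a contradiction»): the
a priori bound (4.3) for all smooth solutions from the data class excludes finite-time blow-up,
i.e. yields Theorem 0.1. Typed as the implication it is used as. [cite: Tennant2025, Cor 3.3 p.8 l.46–60; Cor 4.7 p.11 l.43–49; Props 5.1–5.2 p.11–12; Thm 5.3 p.12 l.88–92] -/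
def Step_KM : Prop := Step_43 → ClaimedTheorem

/-! ## Compositions (pure logic / the print's own arithmetic) -/

/-- **COMPOSITION (solution level)**: (4.3) and the §§3–5 closure give Theorem 0.1, as in the proof
of Thm 5.3 p.12 l.91–92. [cite: Tennant2025, Thm 5.3 p.12 l.88–92; Thm 0.1 p.1] -/
theorem claim_of_steps (h43 : Step_43) (hKM : Step_KM) : ClaimedTheorem := hKM h43

/-- With the delta, the printed chain would settle (A). [cite: Tennant2025, p.13 l.5–7 «Implications»] -/
theorem clayA_of_steps (hΔ : ClayDelta) (h43 : Step_43) (hKM : Step_KM) : clayR3.Regularity :=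
  clay_of_claimed_of_delta hΔ (claim_of_steps h43 hKM)

/-- `log(2 + x) ≤ 1 + x` for `x ≥ 0`. [folklore] -/
private theorem log_two_add_le {x : ℝ} (hx : 0 ≤ x) : Real.log (2 + x) ≤ 1 + x := by
  have h2 : (0 : ℝ) < 2 + x := by linarith
  have := Real.log_le_sub_one_of_pos h2
  linarith

/-- **Step 1 holds** (Lemma 2.3 / A.2 is an elementary true inequality): with `x = 2^j`,
`log(2+x) x³ ≤ (1+x)x³ ≤ (3/2)(x² + x⁴)` since `2x³ ≤ x² + x⁴`; so `c = (2/3)·min(a,b)` works.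
[cite: Tennant2025, Lemma 2.3 p.5 l.12–16] -/
theorem step_L23_holds : Step_L23 := by
  intro a b ha hb
  refine ⟨2 / 3 * min a b, by positivity, fun j => ?_⟩
  have hx : 0 < dy j := dy_pos j
  set x := dy j with hxdef
  have hlog : Real.log (2 + x) ≤ 1 + x := log_two_add_le hx.le
  have hlog0 : 0 ≤ Real.log (2 + x) := Real.log_nonneg (by linarith)
  have hmin_a : min a b ≤ a := min_le_left a b
  have hmin_b : min a b ≤ b := min_le_right a b
  have hmin0 : 0 < min a b := lt_min ha hb
  -- `log(2+x) x³ ≤ (1+x) x³ = x³ + x⁴ ≤ (x² + x⁴)/2 + x⁴ ≤ (3/2)(x² + x⁴)`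
  have h1 : Real.log (2 + x) * x ^ 3 ≤ (1 + x) * x ^ 3 :=
    mul_le_mul_of_nonneg_right hlog (by positivity)
  have h2 : 2 * x ^ 3 ≤ x ^ 2 + x ^ 4 := by nlinarith [sq_nonneg (x - x ^ 2), hx]
  have h3 : Real.log (2 + x) * x ^ 3 ≤ 3 / 2 * (x ^ 2 + x ^ 4) := by nlinarith [h1, h2, hx]
  have h4 : min a b * (x ^ 2 + x ^ 4) ≤ a * x ^ 2 + b * x ^ 4 := by
    nlinarith [hmin_a, hmin_b, sq_nonneg x, pow_nonneg hx.le 4]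
  unfold hWeight
  rw [← hxdef]
  nlinarith [h3, h4, hmin0]

/-- **The print's derivation of (A.6) from (A.5) and Lemma A.2** («From (A.5) and Lemma A.2»,
p.14 l.66), PROVED: termwise `c·log(2+2^j)2^{3j} ≤ A2^{2j} + B2^{4j}` sums to
`c‖u‖²_H ≤ Σ(A2^{2j} + B2^{4j})‖u_j‖²`. So Step 4 stands or falls with Step 3.
[cite: Tennant2025, (A.6) p.14 l.66–69] -/
theorem stepA6_of_L23_A5 (h23 : Step_L23) (h5 : Step_A5) : Step_A6 := by
  intro p hp
  obtain ⟨A, B, hA, hB, hAB⟩ := h5 p hp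
  obtain ⟨c, hc, hcj⟩ := h23 A B hA hB
  refine ⟨c, hc, fun ν hν u hu => ?_⟩
  have hle : ENNReal.ofReal c * hNormE u ≤ dissipE A B u := by
    unfold hNormE dissipE
    rw [← ENNReal.tsum_mul_left]
    refine ENNReal.tsum_le_tsum fun j => ?_
    rw [← mul_assoc, ← ENNReal.ofReal_mul hc.le]
    gcongr
    exact hcj j
  calc ENNReal.ofReal (c * ν) * hNormE u
      = ENNReal.ofReal ν * (ENNReal.ofReal c * hNormE u) := by
        rw [mul_comm c ν, ENNReal.ofReal_mul hν.le, mul_assoc]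
    _ ≤ ENNReal.ofReal ν * dissipE A B u := by gcongr
    _ ≤ ENNReal.ofReal (-viscForm p ν u) := hAB ν hν u hu

/-- A fixed admissible baseline triple `(a,b,λ) = (1, 1, 1/2)` (Lemma 2.4: «for some baseline
triple», p.5 l.71–72). [cite: Tennant2025, Lemma 2.4 p.5 l.71–72] -/
def baseParams : Params := ⟨1, 1, 1 / 2⟩

/-- The baseline triple is admissible. [cite: Tennant2025, Lemma 2.4 p.5 l.71–72] -/
theorem baseParams_admissible : baseParams.Admissible := by
  refine ⟨one_pos, one_pos, by norm_num [baseParams], ?_⟩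
  norm_num [baseParams]

/-- **FIELD-LEVEL COMPOSITION = Lemma 2.4 / A.4 ((2.8)–(2.9)) + Theorem 2.5 / A.5**, PROVED as the
print argues it: from the viscous gain (Step 4), the localisation (Step 5), the bounds (2.6)
(Step 6) and their invariance under common scaling (Step 7), choosing `τ ≥ 4C_trans/(c_vis ν)` and
`γ ≤ τ c_vis ν/(4 C_near)` gives `Visc + Nonlin + (c₀/2)ν‖u‖²_H ≤ 0` with `c₀ = τ c_vis` on the data
class (the print's `2C_trans`, `½τc_visν/C_near` in (2.8)–(2.9) only yield `S_near + S_trans ≤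
c₀ν‖u‖²_H`; the factor is immaterial). [cite: Tennant2025, Lemma 2.4 p.5 l.63–83, p.6 l.1–12; Lemma A.4, Thm A.5 p.15 l.5–41] -/
theorem coerciveSlice_of_steps {γ₀ : ℝ} (hγ₀ : 0 < γ₀) (S : Params → ℝ → (E3 → E3) → ℝ)
    (hA6 : Step_A6) (h23 : Step_23 γ₀ S) (h26 : Step_26 γ₀ S) (hA3 : Step_A3 γ₀ S) :
    CoerciveSlice := by
  intro ν hν
  obtain ⟨cv, hcv, hvisc⟩ := hA6 baseParams baseParams_admissible
  obtain ⟨Cn, Ct, hCn, hCt, hS⟩ := h26 baseParams baseParams_admissible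
  -- the common scale `τ` and the aperture `γ`
  set τ : ℝ := max 1 (4 * Ct / (cv * ν)) with hτdef
  have hτ1 : 1 ≤ τ := le_max_left _ _
  have hτ0 : 0 < τ := lt_of_lt_of_le one_pos hτ1
  have hcvν : 0 < cv * ν := mul_pos hcv hν
  have hq : 0 < τ * cv * ν := by positivity
  set γ : ℝ := if Cn = 0 then γ₀ else min γ₀ (τ * cv * ν / (4 * Cn)) with hγdef
  have hγ0 : 0 < γ := by
    rw [hγdef]; split_ifs with h
    · exact hγ₀
    · exact lt_min hγ₀ (div_pos hq (by positivity))
  have hγ1 : γ ≤ γ₀ := by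
    rw [hγdef]; split_ifs
    · exact le_rfl
    · exact min_le_left _ _
  -- the two absorptions (2.8), (2.9) (with the factor 4)
  have hCt' : Ct ≤ τ * cv * ν / 4 := by
    have : 4 * Ct / (cv * ν) ≤ τ := le_max_right _ _
    rw [div_le_iff₀ hcvν] at this
    linarith
  have hCn' : Cn * γ ≤ τ * cv * ν / 4 := by
    rw [hγdef]; split_ifs with h
    · rw [h, zero_mul]; positivity
    · have hCn0 : 0 < Cn := lt_of_le_of_ne hCn (Ne.symm h)
      calc Cn * min γ₀ (τ * cv * ν / (4 * Cn)) ≤ Cn * (τ * cv * ν / (4 * Cn)) := by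
            gcongr; exact min_le_right _ _
        _ = τ * cv * ν / 4 := by field_simp
  refine ⟨baseParams.scale τ, baseParams_admissible.scale hτ0, τ * cv, by positivity,
    fun u hu => ?_⟩
  have hSτ := hA3 baseParams baseParams_admissible Cn Ct hS τ hτ1 γ hγ0 hγ1 u hu
  have hN := h23 (baseParams.scale τ) (baseParams_admissible.scale hτ0) γ hγ0 hγ1 u hu
  have hV := hvisc ν hν u hu
  -- abbreviations
  set H := hNormE u with hHdef
  set V := viscForm baseParams ν u with hVdef
  set N := nonlinForm (baseParams.scale τ) u with hNdef
  set s := S (baseParams.scale τ) γ u with hsdef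
  rw [viscForm_scale]
  by_cases hH0 : H = 0
  · rw [hH0, mul_zero]; exact zero_le
  -- `H` is finite, by Step 4
  have hHtop : H ≠ ⊤ := by
    intro htop
    rw [htop, ENNReal.mul_top (by simpa using hcvν)] at hV
    exact absurd hV (by simp)
  set h := H.toReal with hhdef
  have hHeq : H = ENNReal.ofReal h := (ENNReal.ofReal_toReal hHtop).symm
  have hh0 : 0 ≤ h := ENNReal.toReal_nonneg
  -- Step 4 in real form: `cv ν h ≤ −V`, and `−V > 0`
  have hV' : cv * ν * h ≤ -V := by
    rw [hHeq, ← ENNReal.ofReal_mul hcvν.le] at hV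
    have hpos : 0 < cv * ν * h := by
      refine mul_pos hcvν (lt_of_le_of_ne hh0 fun h0 => hH0 ?_)
      rw [hHeq, ← h0, ENNReal.ofReal_zero]
    have hnegV : 0 ≤ -V := by
      by_contra hcon
      push Not at hcon
      rw [ENNReal.ofReal_of_nonpos hcon.le] at hV
      exact absurd (le_antisymm hV zero_le) (by simpa using hpos)
    exact (ENNReal.ofReal_le_ofReal_iff hnegV).1 hV
  -- Steps 6–7 in real form: `|s| ≤ (Cn γ + Ct) h ≤ (τ cv ν / 2) h`
  have hs' : |s| ≤ (Cn * γ + Ct) * h := by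
    rw [hHeq, ← ENNReal.ofReal_mul (by positivity)] at hSτ
    exact (ENNReal.ofReal_le_ofReal_iff (by positivity)).1 hSτ
  have hs'' : |s| ≤ τ * cv * ν / 2 * h := by
    calc |s| ≤ (Cn * γ + Ct) * h := hs'
      _ ≤ (τ * cv * ν / 4 + τ * cv * ν / 4) * h := by gcongr
      _ = τ * cv * ν / 2 * h := by ring
  have hNs : N ≤ |s| := hN.trans (le_abs_self s)
  -- conclusion: `(τ cv/2) ν h ≤ −(τ V + N)`
  have hgoal : τ * cv / 2 * ν * h ≤ -(τ * V + N) := by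
    have : τ * (cv * ν * h) ≤ τ * (-V) := mul_le_mul_of_nonneg_left hV' hτ0.le
    nlinarith [this, hs'', hNs]
  rw [hHeq, ← ENNReal.ofReal_mul (by positivity)]
  exact ENNReal.ofReal_le_ofReal hgoal

/-! ## (2.2) p.4 / (A.3) p.13 — `M ≥ 0` on the data class is TRUE (`step_22_holds`) -/

section Step22

open Filter
open scoped NNReal

/-- Cauchy–Schwarz for pairings of `L²` fields: `|∫⟪a, w⟫| ≤ √(∫‖a‖²)·√(∫‖w‖²)`. [folklore] -/
private theorem abs_integral_inner_le_sqrt {a w : E3 → E3} (ha : MemLp a 2 volume)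
    (hw : MemLp w 2 volume) :
    |∫ x, ⟪a x, w x⟫| ≤ Real.sqrt (∫ x, ‖a x‖ ^ 2) * Real.sqrt (∫ x, ‖w x‖ ^ 2) := by
  have h1 : |∫ x, ⟪a x, w x⟫| ≤ ∫ x, ‖a x‖ * ‖w x‖ := by
    rw [← Real.norm_eq_abs]
    refine (norm_integral_le_integral_norm _).trans (integral_mono_of_nonneg
      (ae_of_all _ fun x => norm_nonneg _) (ha.norm.integrable_mul hw.norm)
      (ae_of_all _ fun x => norm_inner_le_norm _ _))
  have h2 := integral_mul_le_Lp_mul_Lq_of_nonneg Real.HolderConjugate.two_two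
    (ae_of_all _ fun x => norm_nonneg (a x)) (ae_of_all _ fun x => norm_nonneg (w x))
    (by simpa using ha.norm) (by simpa using hw.norm)
  refine h1.trans (h2.trans_eq ?_)
  simp only [Real.rpow_two, one_div, Real.sqrt_eq_rpow]

/-- `|⟨Δ_j v, Δ_j w⟩| ≤ ‖Δ_j v‖₂‖Δ_j w‖₂`. [folklore] -/
private theorem abs_blockPair_le {v w : E3 → E3} (hv : MemLp v 2 volume) (hw : MemLp w 2 volume)
    (j : ℤ) : |blockPair j v w| ≤ Real.sqrt (blockL2sq j v) * Real.sqrt (blockL2sq j w) := by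
  unfold blockPair blockL2sq
  exact abs_integral_inner_le_sqrt (memLp_blockFn j hv one_le_two) (memLp_blockFn j hw one_le_two)

/-- Each dyadic term of `M` is non-negative when `λ² < ab` (`a(a4^jB + bW − 2λ2^j√B√W) =
(a2^j√B − λ√W)² + (ab − λ²)W`). [cite: Tennant2025, (2.2) p.4 l.53–77] -/
private theorem morawetz_term_nonneg {p : Params} (hp : p.Admissible) {v : E3 → E3}
    (hv : MemLp v 2 volume) (hw : MemLp (curl v) 2 volume) (j : ℤ) :
    0 ≤ p.a * (dy j ^ 2 * blockL2sq j v) + p.b * blockL2sq j (curl v)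
      - 2 * p.lam * (dy j * blockPair j v (curl v)) := by
  obtain ⟨ha, hb, hl, hab⟩ := hp
  have hB : 0 ≤ blockL2sq j v := integral_nonneg fun x => sq_nonneg _
  have hW : 0 ≤ blockL2sq j (curl v) := integral_nonneg fun x => sq_nonneg _
  have hsB : Real.sqrt (blockL2sq j v) ^ 2 = blockL2sq j v := Real.sq_sqrt hB
  have hsW : Real.sqrt (blockL2sq j (curl v)) ^ 2 = blockL2sq j (curl v) := Real.sq_sqrt hW
  have hd : 0 < dy j := zpow_pos two_pos j
  have hP : blockPair j v (curl v) ≤ Real.sqrt (blockL2sq j v) * Real.sqrt (blockL2sq j (curl v)) :=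
    (le_abs_self _).trans (abs_blockPair_le hv hw j)
  have h1 : p.lam * dy j * blockPair j v (curl v) ≤
      p.lam * dy j * (Real.sqrt (blockL2sq j v) * Real.sqrt (blockL2sq j (curl v))) :=
    mul_le_mul_of_nonneg_left hP (mul_pos hl hd).le
  have key : p.a * (p.a * dy j ^ 2 * Real.sqrt (blockL2sq j v) ^ 2 + p.b * Real.sqrt (blockL2sq j (curl v)) ^ 2
      - 2 * p.lam * dy j * Real.sqrt (blockL2sq j v) * Real.sqrt (blockL2sq j (curl v))) =
      (p.a * dy j * Real.sqrt (blockL2sq j v) - p.lam * Real.sqrt (blockL2sq j (curl v))) ^ 2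
        + (p.a * p.b - p.lam ^ 2) * Real.sqrt (blockL2sq j (curl v)) ^ 2 := by ring
  have hQ : 0 ≤ p.a * dy j ^ 2 * Real.sqrt (blockL2sq j v) ^ 2 + p.b * Real.sqrt (blockL2sq j (curl v)) ^ 2
      - 2 * p.lam * dy j * Real.sqrt (blockL2sq j v) * Real.sqrt (blockL2sq j (curl v)) := by
    have h0 := add_nonneg (sq_nonneg (p.a * dy j * Real.sqrt (blockL2sq j v) - p.lam * Real.sqrt (blockL2sq j (curl v))))
      (mul_nonneg (sub_nonneg.2 hab.le) (sq_nonneg (Real.sqrt (blockL2sq j (curl v)))))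
    rw [← key] at h0
    exact (mul_nonneg_iff_of_pos_left ha).1 h0
  rw [hsB, hsW] at hQ
  linarith [hQ, h1]

/-- Test fields are in `L²`. [folklore] -/
private theorem memLp_two_of_test {u : E3 → E3} (hu : IsTestField u) : MemLp u 2 volume :=
  hu.1.continuous.memLp_of_hasCompactSupport hu.2.1

/-- The derivative of a test field is smooth. [folklore] -/
private theorem contDiff_fderiv_of_test {u : E3 → E3} (hu : IsTestField u) :
    ContDiff ℝ ∞ (fderiv ℝ u) :=
  (contDiff_infty_iff_fderiv.1 hu.1).2

/-- The curl of a test field is in `L²` (continuous with compact support). [folklore] -/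
private theorem memLp_two_curl_of_test {u : E3 → E3} (hu : IsTestField u) : MemLp (curl u) 2 volume := by
  have hc : Continuous (curl u) := by
    rw [curl_eq_curlCLM_comp]; exact curlCLM.continuous.comp (contDiff_fderiv_of_test hu).continuous
  have hs : HasCompactSupport (curl u) := by
    rw [curl_eq_curlCLM_comp]; exact (hu.2.1.fderiv (𝕜 := ℝ)).comp_left (map_zero curlCLM)
  exact hc.memLp_of_hasCompactSupport hs

/-- The partial derivatives of a test field are in `L²`. [folklore] -/
private theorem memLp_two_fderiv_apply_of_test {u : E3 → E3} (hu : IsTestField u) (m : E3) :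
    MemLp (fun x => fderiv ℝ u x m) 2 volume :=
  ((contDiff_fderiv_of_test hu).continuous.clm_apply continuous_const).memLp_of_hasCompactSupport
    (hu.2.1.fderiv_apply (𝕜 := ℝ) m)

/-- Test fields are `C¹ ∩ L²` fields in the sense of `IsC1L2Field` (the hypothesis class of the tree's
Bernstein lemmas). [folklore] -/
private theorem isC1L2Field_of_test {u : E3 → E3} (hu : IsTestField u) : IsC1L2Field u := by
  obtain ⟨M₀, hM₀⟩ := hu.1.continuous.bounded_above_of_compact_support hu.2.1
  obtain ⟨M₁, hM₁⟩ :=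
    (contDiff_fderiv_of_test hu).continuous.bounded_above_of_compact_support (hu.2.1.fderiv (𝕜 := ℝ))
  exact ⟨hu.1.of_le (mod_cast le_top), memLp_two_of_test hu, ⟨M₀, hM₀⟩, ⟨M₁, hM₁⟩,
    memLp_two_fderiv_apply_of_test hu⟩

/-- `‖Δ_j v‖²₂` (Bochner) as the real part of the lower integral. [folklore] -/
private theorem blockL2sq_eq_toReal (j : ℤ) {v : E3 → E3} (hv : MemLp v 2 volume) :
    blockL2sq j v = (∫⁻ x, ‖blockFn j v x‖ₑ ^ 2).toReal := by
  unfold blockL2sq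
  rw [integral_eq_lintegral_of_nonneg_ae (Eventually.of_forall fun x => sq_nonneg _)
    ((aestronglyMeasurable_blockFn j hv.1).norm.aemeasurable.pow_const 2).aestronglyMeasurable]
  congr 1
  refine lintegral_congr fun x => ?_
  rw [ENNReal.ofReal_pow (norm_nonneg _), ofReal_norm]

/-- Summability of the block energies of an `L²` field (square function bound). [folklore] -/
private theorem summable_blockL2sq {v : E3 → E3} (hv : MemLp v 2 volume) :
    Summable fun j : ℤ => blockL2sq j v := by
  have hfin : (∑' j : ℤ, eLpNorm (blockFn j v) 2 volume ^ 2) ≠ ⊤ :=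
    ne_top_of_le_ne_top (ENNReal.mul_ne_top (by norm_num) (ENNReal.pow_ne_top hv.eLpNorm_ne_top))
      (tsum_eLpNorm_blockFn_sq_le hv)
  refine (ENNReal.summable_toReal hfin).congr fun j => ?_
  rw [eLpNorm_two_sq_eq_lintegral, blockL2sq_eq_toReal j hv]

/-- `‖Δ_j v‖_{L²} = √(blockL2sq j v)`. [folklore] -/
private theorem toReal_eLpNorm_blockFn (j : ℤ) {v : E3 → E3} (hv : MemLp v 2 volume) :
    (eLpNorm (blockFn j v) 2 volume).toReal = Real.sqrt (blockL2sq j v) := by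
  have h : (eLpNorm (blockFn j v) 2 volume).toReal ^ 2 = blockL2sq j v := by
    rw [← ENNReal.toReal_pow, eLpNorm_two_sq_eq_lintegral, blockL2sq_eq_toReal j hv]
  rw [← h, Real.sqrt_sq ENNReal.toReal_nonneg]

/-- Summability of `Σ_j 4^j ‖Δ_j u‖²₂` for a test field (reverse Bernstein + square function on the
derivatives). [folklore] -/
private theorem summable_dy_sq_mul_blockL2sq {u : E3 → E3} (hu : IsTestField u) :
    Summable fun j : ℤ => dy j ^ 2 * blockL2sq j u := by
  set b := EuclideanSpace.basisFun (Fin 3) ℝ with hb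
  obtain ⟨C, hC⟩ := exists_eLpNorm_blockFn_le_sum_fderiv (ι := Fin 3) b
  have hU := isC1L2Field_of_test hu
  have hmem := memLp_two_of_test hu
  have hD : ∀ i, MemLp (fun x => fderiv ℝ u x (b i)) 2 volume :=
    fun i => memLp_two_fderiv_apply_of_test hu (b i)
  have hsum : Summable fun j : ℤ => 3 * (C : ℝ) ^ 2 *
      ∑ i, blockL2sq j (fun x => fderiv ℝ u x (b i)) :=
    (summable_sum fun i _ => summable_blockL2sq (hD i)).mul_left _
  refine Summable.of_nonneg_of_le
    (fun j => mul_nonneg (sq_nonneg _) (integral_nonneg fun x => sq_nonneg _)) (fun j => ?_) hsum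
  -- the reverse Bernstein inequality at level `j`, in real numbers
  have h1 := hC j u hU
  have h2 : ∀ i, eLpNorm (fun x => fderiv ℝ (blockFn j u) x (b i)) 2 volume =
      eLpNorm (blockFn j (fun x => fderiv ℝ u x (b i))) 2 volume := fun i => by
    rw [hU.fderiv_blockFn_apply j (b i)]
  simp_rw [h2] at h1
  have hpow : (2 : ℝ≥0∞) ^ (-(j : ℝ)) = ENNReal.ofReal ((2 : ℝ) ^ (-(j : ℝ))) := by
    rw [← ENNReal.ofReal_ofNat 2, ENNReal.ofReal_rpow_of_pos (by norm_num)]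
  rw [hpow] at h1
  have hfinR : ∀ i, eLpNorm (blockFn j (fun x => fderiv ℝ u x (b i))) 2 volume ≠ ⊤ := fun i =>
    (memLp_blockFn j (hD i) one_le_two).eLpNorm_ne_top
  have hr : 0 < (2 : ℝ) ^ (-(j : ℝ)) := Real.rpow_pos_of_pos two_pos _
  set N : ℝ := (eLpNorm (blockFn j u) 2 volume).toReal with hN
  set S : ℝ := ∑ i, (eLpNorm (blockFn j (fun x => fderiv ℝ u x (b i))) 2 volume).toReal with hS
  have h3 : N ≤ (C : ℝ) * (2 : ℝ) ^ (-(j : ℝ)) * S := by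
    have hne : (C : ℝ≥0∞) * ENNReal.ofReal ((2 : ℝ) ^ (-(j : ℝ))) *
        ∑ i, eLpNorm (blockFn j (fun x => fderiv ℝ u x (b i))) 2 volume ≠ ⊤ :=
      ENNReal.mul_ne_top (ENNReal.mul_ne_top ENNReal.coe_ne_top ENNReal.ofReal_ne_top)
        (ENNReal.sum_ne_top.2 fun i _ => hfinR i)
    have := ENNReal.toReal_mono hne h1
    rwa [ENNReal.toReal_mul, ENNReal.toReal_mul, ENNReal.toReal_sum (fun i _ => hfinR i),
      ENNReal.coe_toReal, ENNReal.toReal_ofReal hr.le] at this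
  have hdj : dy j * (2 : ℝ) ^ (-(j : ℝ)) = 1 := by
    rw [Real.rpow_neg zero_le_two, Real.rpow_intCast, dy, mul_inv_cancel₀ (zpow_ne_zero j two_ne_zero)]
  have hd : 0 < dy j := zpow_pos two_pos j
  have h4 : dy j * N ≤ (C : ℝ) * S := by
    calc dy j * N ≤ dy j * ((C : ℝ) * (2 : ℝ) ^ (-(j : ℝ)) * S) := mul_le_mul_of_nonneg_left h3 hd.le
      _ = (C : ℝ) * (dy j * (2 : ℝ) ^ (-(j : ℝ))) * S := by ring
      _ = (C : ℝ) * S := by rw [hdj, mul_one]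
  have hN0 : 0 ≤ N := ENNReal.toReal_nonneg
  have hS3 : S ^ 2 ≤ 3 * ∑ i, (eLpNorm (blockFn j (fun x => fderiv ℝ u x (b i))) 2 volume).toReal ^ 2 := by
    have := sq_sum_le_card_mul_sum_sq (s := (Finset.univ : Finset (Fin 3)))
      (f := fun i => (eLpNorm (blockFn j (fun x => fderiv ℝ u x (b i))) 2 volume).toReal)
    simpa [hS] using this
  have hNsq : N ^ 2 = blockL2sq j u := by
    have h0 : 0 ≤ blockL2sq j u := integral_nonneg fun x => sq_nonneg _
    rw [hN, toReal_eLpNorm_blockFn j hmem, Real.sq_sqrt h0]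
  have hDsq : ∀ i, (eLpNorm (blockFn j (fun x => fderiv ℝ u x (b i))) 2 volume).toReal ^ 2 =
      blockL2sq j (fun x => fderiv ℝ u x (b i)) := fun i => by
    have h0 : 0 ≤ blockL2sq j (fun x => fderiv ℝ u x (b i)) := integral_nonneg fun x => sq_nonneg _
    rw [toReal_eLpNorm_blockFn j (hD i), Real.sq_sqrt h0]
  simp_rw [hDsq] at hS3
  have h5 : (dy j * N) ^ 2 ≤ ((C : ℝ) * S) ^ 2 := pow_le_pow_left₀ (mul_nonneg hd.le hN0) h4 2
  calc dy j ^ 2 * blockL2sq j u = (dy j * N) ^ 2 := by rw [mul_pow, hNsq]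
    _ ≤ ((C : ℝ) * S) ^ 2 := h5
    _ = (C : ℝ) ^ 2 * S ^ 2 := by ring
    _ ≤ (C : ℝ) ^ 2 * (3 * ∑ i, blockL2sq j (fun x => fderiv ℝ u x (b i))) :=
        mul_le_mul_of_nonneg_left hS3 (sq_nonneg _)
    _ = 3 * (C : ℝ) ^ 2 * ∑ i, blockL2sq j (fun x => fderiv ℝ u x (b i)) := by ring

/-- **Step 2 — (2.2) p.4 / (A.3) p.13 is TRUE**: for admissible `(a, b, λ)` (`λ² < ab`) the Morawetz
functional `M = a Σ4^j‖u_j‖² + b Σ‖ω_j‖² − 2λ Σ2^j⟨u_j, ω_j⟩` is non-negative on the data class. Each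
dyadic term is a positive-semidefinite form in (`2^j‖u_j‖₂`, `‖ω_j‖₂`) by Cauchy–Schwarz, and the three
series converge for test fields (Littlewood–Paley square function bound and reverse Bernstein, tree
`tsum_eLpNorm_blockFn_sq_le`, `exists_eLpNorm_blockFn_le_sum_fderiv`), so `M` is the sum of its
non-negative dyadic terms. [cite: Tennant2025, (2.2) p.4 l.53–77; (A.3) p.13 l.30–54] -/
theorem step_22_holds : Step_22 := by
  intro p hp u hu
  have hmem := memLp_two_of_test hu
  have hcurl := memLp_two_curl_of_test hu
  have hl : 0 < p.lam := hp.2.2.1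
  have hS1 : Summable fun j : ℤ => dy j ^ 2 * blockL2sq j u := summable_dy_sq_mul_blockL2sq hu
  have hS2 : Summable fun j : ℤ => blockL2sq j (curl u) := summable_blockL2sq hcurl
  have hS3 : Summable fun j : ℤ => dy j * blockPair j u (curl u) := by
    refine Summable.of_norm_bounded ((hS1.add hS2).div_const 2) fun j => ?_
    have hd : 0 < dy j := zpow_pos two_pos j
    have hB : 0 ≤ blockL2sq j u := integral_nonneg fun x => sq_nonneg _
    have hW : 0 ≤ blockL2sq j (curl u) := integral_nonneg fun x => sq_nonneg _
    have hP := abs_blockPair_le hmem hcurl j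
    have hsB : Real.sqrt (blockL2sq j u) ^ 2 = blockL2sq j u := Real.sq_sqrt hB
    have hsW : Real.sqrt (blockL2sq j (curl u)) ^ 2 = blockL2sq j (curl u) := Real.sq_sqrt hW
    rw [Real.norm_eq_abs, abs_mul, abs_of_pos hd]
    have h2 := two_mul_le_add_sq (dy j * Real.sqrt (blockL2sq j u)) (Real.sqrt (blockL2sq j (curl u)))
    rw [mul_pow, hsB, hsW] at h2
    have h3 : dy j * |blockPair j u (curl u)| ≤
        dy j * (Real.sqrt (blockL2sq j u) * Real.sqrt (blockL2sq j (curl u))) :=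
      mul_le_mul_of_nonneg_left hP hd.le
    linarith
  have e : morawetzM p u = ∑' j : ℤ, (p.a * (dy j ^ 2 * blockL2sq j u) + p.b * blockL2sq j (curl u)
      - 2 * p.lam * (dy j * blockPair j u (curl u))) := by
    unfold morawetzM
    rw [← tsum_mul_left, ← tsum_mul_left, ← tsum_mul_left,
      ← Summable.tsum_add (hS1.mul_left _) (hS2.mul_left _),
      ← Summable.tsum_sub ((hS1.mul_left _).add (hS2.mul_left _)) (hS3.mul_left _)]
  rw [e]
  exact tsum_nonneg fun j => morawetz_term_nonneg hp hmem hcurl j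

/-- `Step_22` — `_holds` alias of `step_22_holds` above under the fact's exact name (appended
2026-08-28, D-0026 bookkeeping: the proof term is the existing theorem of this file; no statement,
definition or attribute is edited; no new named fact; the ledger's debt table listed the fact
unproved). [cite: Tennant2025, (2.2) p.4 l.53–77; (A.3) p.13 l.30–54] -/
theorem _root_.Literature.Claims.NS.Tennant2025.Step_22_holds : Step_22 :=
  _root_.Literature.Claims.NS.Tennant2025.step_22_holds

end Step22

end

end Literature.Claims.NS.Tennant2025
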